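import Summits.Ventures.YMGap.RobustBall.WindowTiltDefect
import Summits.Ventures.YMGap.RobustBall.LocalSourceScreeningStar
import Literature.Probability.LatticeModels.DobrushinShlosmanSuperSolutionStates
import HarnessLib

/-!
# Venture YMGap, track ROBUST-BALL (Y2) — SCREENED STATE STABILITY THROUGH THE STAR DOOR: the state map of a tier-1 member with a star
# window bound is quasi-local in the action — window loads `≤ B₀` on the stars near the observable and `≤ B₁` far away give
# `|∫ f dμ − ∫ f dν| ≤ (2√N/(1−ρ))·(min(e^{B₀}−1,2) + min(e^{B₁}−1,2)·ρ^{⌊(r−1)/(D+2)⌋})·Σδ`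

HONEST FRAMING. WHAT THIS IS: a venture file (cell `pub-ymgap`, track Y2 ROBUST-BALL, seat rb-p1, theorems only): the STAR-DOOR twin of the
tier-2 `ScreenedStabilityS.lean` and the two-level refinement of `LocalSourceScreeningStarDefect.lean` (there: a source supported on a FINITE
link set `S`; here: an arbitrary bounded, adapted, locally listed modification `V`, measured only by the WINDOW LOADS of its oscillation
witnesses on the vertex stars — `≤ B₁` on every star, `≤ B₀` on the stars whose centre lies within `ℓ^∞`-distance `r` of the observable's link set
`Δ`).  Member `(W, supp)`: continuous own-link terms of range `R`, a star window bound with locality radius `D ≥ R + 2` and received sum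
`0 ≤ ρ < 1` (every star cell of the lane supplies one, up to `β_W = 1/3` for `SU(2)` on `ℤ⁴`).
* ★ `abs_integral_sub_integral_le_of_perturbation_screened_star` — for every DLR `μ` of the member and EVERY DLR `ν` of `W + V`, every bounded
  measurable `f` reading `Δ` with Frobenius-Lipschitz vector `δ`:
  `|∫ f dμ − ∫ f dν| ≤ (2√N/(1 − ρ))·(min(e^{B₀} − 1, 2) + min(e^{B₁} − 1, 2)·ρ^{⌊max(r−1,0)/(D+2)⌋})·Σ_{y ∈ Δ} δ y`
  (Literature `abs_integral_sub_integral_le_of_window_pair_defect` with the THREE-profile super-solution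
  `d = K₀ + K₁ ρ^{⌊max(r−1−dist(·,Δ),0)/(D+2)⌋} + 2√N ρ^{ℓ_∂}`, `L₀ → ∞`).
WHAT THIS IS NOT: the clustering/derivative consequences through the star door (the tier-2 chain `DirectionalSusceptibilityS` →
`StateDerivativeOnBallS` has a star twin still to be written); lattice strong coupling only; nothing about the continuum limit or a Clay-sense
mass gap.
-/

noncomputable section

open MeasureTheory ProbabilityTheory Function Finset Real
open scoped NNReal
open Literature.Probability.LatticeModels
open Literature.Probability.LatticeModels.DobrushinMetric (IsLipBound integrable_of_abs_le' abs_sub_le_mul_sum_of_dependsOn)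
open Literature.MathematicalPhysics.QuantumLattice
open Literature.MathematicalPhysics.QuantumFieldTheory hiding ZdEdge Site
open Summit.Ventures.YMGap.DSWindowZd

namespace Summit.Ventures.YMGap.RobustBall

variable {d N : ℕ}

set_option maxHeartbeats 400000 in
/-- ★ **SCREENED STATE STABILITY THROUGH THE STAR DOOR.**  Member `(W, supp)` (continuous own-link terms, `ℓ^∞` range `R`, star window bound
with locality radius `D ≥ R + 2`, received sum `0 ≤ ρ < 1`); modification `(V, suppV)` bounded, adapted, locally listed, of ANY strength, with
one-link oscillation witnesses `oscV` whose window loads are `≤ B₁` on every vertex star and `≤ B₀` on the stars centred within `ℓ^∞`-distance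
`r` of `Δ` (`0 ≤ B₀`, `0 ≤ B₁`).  Then every DLR `μ` of the member and EVERY DLR `ν` of `W + V` satisfy, for every bounded measurable `f` reading
`Δ` with Frobenius-Lipschitz vector `δ`:
`|∫ f dμ − ∫ f dν| ≤ (2√N/(1 − ρ))·(min(e^{B₀}−1,2) + min(e^{B₁}−1,2)·ρ^{⌊max(r−1,0)/(D+2)⌋})·Σ_{y ∈ Δ} δ y`. -/
theorem abs_integral_sub_integral_le_of_perturbation_screened_star {β ρ B₀ B₁ r : ℝ} {R D : ℕ}
    {W : Potential (ZdEdge d) (SUN N)} (hWc : ∀ X, Continuous (W X))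
    (hWdep : ∀ X, DependsOn (W X) (↑X : Set (ZdEdge d)))
    {supp : Finset (ZdEdge d) → Finset (Finset (ZdEdge d))} (hsupp : W.IsSupportedBy supp)
    (hR : ∀ e, ∀ X ∈ supp {e}, e ∈ X → ∀ y ∈ X, ‖e.1 - y.1‖ ≤ (R : ℝ)) (hD : R + 2 ≤ D)
    (hρ0 : 0 ≤ ρ) (hρ1 : ρ < 1)
    (h : StarWindowBoundZdR d N (perturbedYM (d := d) (fundamentalRep (Fin N)) (N * β) W supp) D ρ
      suFrobDist)
    {V : Potential (ZdEdge d) (SUN N)} (hV : V.IsAdapted) (hVb : ∀ X, ∃ C, ∀ U, |V X U| ≤ C)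
    {suppV : Finset (ZdEdge d) → Finset (Finset (ZdEdge d))} (hsuppV : V.IsSupportedBy suppV)
    {oscV : Finset (ZdEdge d) → ZdEdge d → ℝ} (hoscV : ∀ X, Dobrushin.IsOscBound (V X) (oscV X))
    (hB₀ : 0 ≤ B₀) (hB₁ : 0 ≤ B₁) {Δ : Finset (ZdEdge d)}
    (hfar : ∀ c : ZdEdge d, windowLoad d suppV oscV (starWinZd c) ≤ B₁)
    (hnear : ∀ c : ZdEdge d, linkSetDist Δ c ≤ r → windowLoad d suppV oscV (starWinZd c) ≤ B₀)
    {μ ν : Measure (LGConfig d (SUN N))}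
    (hμ : μ ∈ perturbedGibbsMeasures (d := d) (fundamentalRep (Fin N)) (N * β) W supp)
    (hν : ν ∈ perturbedGibbsMeasures (d := d) (fundamentalRep (Fin N)) (N * β) (W + V)
      (fun Λ => supp Λ ∪ suppV Λ))
    {f : LGConfig d (SUN N) → ℝ} (hfm : Measurable f) {Bf : ℝ} (hBf : ∀ σ, |f σ| ≤ Bf)
    (hfdep : DependsOn f (↑Δ : Set (ZdEdge d)))
    {δ : ZdEdge d → ℝ} (hδ : IsLipBound suFrobDist f δ) :
    |(∫ σ, f σ ∂μ) - ∫ σ, f σ ∂ν| ≤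
      2 * Real.sqrt N / (1 - ρ) * (min (Real.exp B₀ - 1) 2 + min (Real.exp B₁ - 1) 2 * ρ ^ ⌊max (r - 1) 0 / (D + 2 : ℕ)⌋₊) *
        ∑ y ∈ Δ, δ y := by
  classical
  haveI : SecondCountableTopology (Matrix (Fin N) (Fin N) ℂ) :=
    inferInstanceAs (SecondCountableTopology (Fin N → Fin N → ℂ))
  haveI : SecondCountableTopology (SUN N) := Topology.IsEmbedding.subtypeVal.secondCountableTopology
  have hW : W.IsAdapted := fun X => ⟨hWdep X, (hWc X).measurable⟩
  have hWb : ∀ X, ∃ C, ∀ U, |W X U| ≤ C := fun X => exists_bound_of_continuous (hWc X)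
  have hWV : (W + V).IsAdapted := isAdapted_add hW hV
  have hWVb : ∀ X, ∃ C, ∀ U, |(W + V) X U| ≤ C := fun X => by
    obtain ⟨C₁, h₁⟩ := hWb X; obtain ⟨C₂, h₂⟩ := hVb X
    exact ⟨C₁ + C₂, fun U => (abs_add_le _ _).trans (add_le_add (h₁ U) (h₂ U))⟩
  have hγ : IsSpecification (perturbedYM (d := d) (fundamentalRep (Fin N)) (N * β) W supp) :=
    isSpecification_perturbedYM _ (continuous_fundamentalRep (Fin N)) _ hW hWb hsupp
  have hγ' : IsSpecification (perturbedYM (d := d) (fundamentalRep (Fin N)) (N * β) (W + V)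
      (fun Λ => supp Λ ∪ suppV Λ)) :=
    isSpecification_perturbedYM _ (continuous_fundamentalRep (Fin N)) _ hWV hWVb (isSupportedBy_add_union hsupp hsuppV)
  have hμ' : IsGibbsMeasure (perturbedYM (d := d) (fundamentalRep (Fin N)) (N * β) W supp) μ := hμ
  have hν' : IsGibbsMeasure (perturbedYM (d := d) (fundamentalRep (Fin N)) (N * β) (W + V)
      (fun Λ => supp Λ ∪ suppV Λ)) ν := hν
  have hD1 : 1 ≤ D := by omega
  have hloc : ∀ (c : ZdEdge d) (ζ ζ' : LGConfig d (SUN N)), (∀ v ∈ starNbhdZdR D c.1, ζ v = ζ' v) →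
      ∀ (g : LGConfig d (SUN N) → ℝ), Measurable g → (∃ B, ∀ σ, |g σ| ≤ B) →
        DependsOn g (starWinZd c : Set (ZdEdge d)) →
        ∫ σ, g σ ∂(perturbedYM (d := d) (fundamentalRep (Fin N)) (N * β) W supp (starWinZd c) ζ) =
          ∫ σ, g σ ∂(perturbedYM (d := d) (fundamentalRep (Fin N)) (N * β) W supp (starWinZd c) ζ') :=
    fun c ζ ζ' hζ g hgm _ hgdep => perturbed_star_hloc _ (continuous_fundamentalRep (Fin N)) _
      (fun X => (hWc X).measurable) hWdep hsupp hR hD c ζ ζ' hζ g hgm hgdep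
  obtain ⟨K, hK0, hKsupp, hcontract, hsum⟩ := h
  have hR₀ : (0 : ℝ) ≤ 2 * Real.sqrt N := by positivity
  -- constants
  set κ₀ : ℝ := min (Real.exp B₀ - 1) 2 with hκ₀
  set κ₁ : ℝ := min (Real.exp B₁ - 1) 2 with hκ₁
  have hκ₀0 : 0 ≤ κ₀ := le_min (by linarith [Real.add_one_le_exp B₀]) (by norm_num)
  have hκ₁0 : 0 ≤ κ₁ := le_min (by linarith [Real.add_one_le_exp B₁]) (by norm_num)
  have h1ρ : 0 < 1 - ρ := sub_pos.2 hρ1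
  set K₀ : ℝ := 2 * Real.sqrt N * κ₀ / (1 - ρ) with hK₀
  set K₁ : ℝ := 2 * Real.sqrt N * κ₁ / (1 - ρ) with hK₁
  have hK₀0 : 0 ≤ K₀ := by rw [hK₀]; positivity
  have hK₁0 : 0 ≤ K₁ := by rw [hK₁]; positivity
  -- the defect array: `2√N κ₀` on the near stars, `2√N κ₁` on the far ones
  set κarr : ZdEdge d → ZdEdge d → ℝ := fun c _ => if linkSetDist Δ c ≤ r then 2 * Real.sqrt N * κ₀ else 2 * Real.sqrt N * κ₁ with hκarr
  have hκarr0 : ∀ c x, 0 ≤ κarr c x := fun c x => by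
    simp only [hκarr]; split_ifs <;> positivity
  -- the near profile: `ℓN x = ⌊max(r − 1 − dist(x,Δ), 0)/(D+2)⌋`, large on `Δ`, zero far away
  set ℓN : ZdEdge d → ℕ := fun x => ⌊max (r - 1 - linkSetDist Δ x) 0 / (D + 2 : ℕ)⌋₊ with hℓN
  have hD2 : (0 : ℝ) < (D + 2 : ℕ) := by positivity
  have hℓN_lip : ∀ (c : ZdEdge d) x y, x ∈ starWinZd c → K c.1 y x ≠ 0 → (ℓN x ≤ ℓN y + 1 ∧ ℓN y ≤ ℓN x + 1) := by
    intro c x y hxc hK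
    have hy : y ∈ starNbhdZdR D c.1 := hKsupp _ _ _ hK
    have hyx : ‖x.1 - y.1‖ ≤ ((D + 1 : ℕ) : ℝ) := by
      refine norm_le_of_natAbs_le fun i => ?_
      have h1 := natAbs_sub_le_one_of_mem_vertexStarZd hxc i
      have h2 := (mem_starNbhdZdR.1 hy) i
      simp only [Pi.sub_apply]
      omega
    have h4 : ((D + 1 : ℕ) : ℝ) ≤ ((D + 2 : ℕ) : ℝ) := by exact_mod_cast Nat.le_succ _
    have hxy1 := linkSetDist_le_add_norm Δ x y
    have hyx1 := linkSetDist_le_add_norm Δ y x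
    rw [norm_sub_rev] at hyx1
    have hm1 : max (r - 1 - linkSetDist Δ x) 0 ≤ max (r - 1 - linkSetDist Δ y) 0 + (D + 2 : ℕ) := by
      rcases le_total (r - 1 - linkSetDist Δ x) 0 with h0 | h0
      · rw [max_eq_right h0]; exact add_nonneg (le_max_right _ _) hD2.le
      · rw [max_eq_left h0]; linarith [le_max_left (r - 1 - linkSetDist Δ y) 0]
    have hm2 : max (r - 1 - linkSetDist Δ y) 0 ≤ max (r - 1 - linkSetDist Δ x) 0 + (D + 2 : ℕ) := by
      rcases le_total (r - 1 - linkSetDist Δ y) 0 with h0 | h0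
      · rw [max_eq_right h0]; exact add_nonneg (le_max_right _ _) hD2.le
      · rw [max_eq_left h0]; linarith [le_max_left (r - 1 - linkSetDist Δ x) 0]
    constructor
    · calc ℓN x ≤ ⌊max (r - 1 - linkSetDist Δ y) 0 / (D + 2 : ℕ) + 1⌋₊ := Nat.floor_mono (by
            rw [div_add_one hD2.ne', le_div_iff₀ hD2]; rw [div_mul_cancel₀ _ hD2.ne']; exact hm1)
        _ = ℓN y + 1 := Nat.floor_add_one (div_nonneg (le_max_right _ _) hD2.le)
    · calc ℓN y ≤ ⌊max (r - 1 - linkSetDist Δ x) 0 / (D + 2 : ℕ) + 1⌋₊ := Nat.floor_mono (by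
            rw [div_add_one hD2.ne', le_div_iff₀ hD2]; rw [div_mul_cancel₀ _ hD2.ne']; exact hm2)
        _ = ℓN x + 1 := Nat.floor_add_one (div_nonneg (le_max_right _ _) hD2.le)
  -- a star whose window holds a point of positive near depth is a near star
  have hℓN_near : ∀ (c : ZdEdge d) x, x ∈ starWinZd c → ℓN x ≠ 0 → linkSetDist Δ c ≤ r := by
    intro c x hxc hne
    have hpos : (D + 2 : ℕ) ≤ max (r - 1 - linkSetDist Δ x) 0 := by
      by_contra hlt
      exact hne (Nat.floor_eq_zero.2 ((div_lt_one hD2).2 (not_le.1 hlt)))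
    have hD' : (1 : ℝ) ≤ ((D + 2 : ℕ) : ℝ) := by exact_mod_cast (show 1 ≤ D + 2 by omega)
    have hmax : 0 < max (r - 1 - linkSetDist Δ x) 0 := by linarith
    have hval : max (r - 1 - linkSetDist Δ x) 0 = r - 1 - linkSetDist Δ x := max_eq_left (by
      by_contra hneg; rw [max_eq_right (not_le.1 hneg).le] at hmax; exact lt_irrefl _ hmax)
    have hxc1 : ‖c.1 - x.1‖ ≤ ((1 : ℕ) : ℝ) := by
      refine norm_le_of_natAbs_le fun i => ?_
      have h1 := natAbs_sub_le_one_of_mem_vertexStarZd hxc i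
      simp only [Pi.sub_apply]
      omega
    have h3 := linkSetDist_le_add_norm Δ c x
    push_cast at hxc1
    linarith
  -- for every depth `L₀`: the bound with the boundary term `2√N ρ^{L₀}`
  have main : ∀ L₀ : ℕ, |(∫ σ, f σ ∂μ) - ∫ σ, f σ ∂ν| ≤
      (K₀ + K₁ * ρ ^ ⌊max (r - 1) 0 / (D + 2 : ℕ)⌋₊) * ∑ y ∈ Δ, δ y + 2 * Real.sqrt N * ρ ^ L₀ * ∑ y ∈ Δ, δ y := by
    intro L₀
    obtain ⟨Λ, ℓ, hΔΛ, hU, hℓ, hL⟩ := exists_starExhaustionR D K hKsupp Δ L₀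
    set dsol : ZdEdge d → ℝ := fun x => K₀ + K₁ * ρ ^ ℓN x + 2 * Real.sqrt N * ρ ^ ℓ x with hdsol
    have key := DobrushinShlosman.abs_integral_sub_integral_le_of_window_pair_defect hγ hγ' suFrobDist_nonneg suFrobDist_le
      hR₀ (win := starWinZd) (nbhd := fun c => starNbhdZdR D c.1) (K := fun c => K c.1) (fun c y x => hK0 _ _ _)
      (fun c => vertexStarZd_subset_starNbhdZdR hD1 c.1) (fun c y x => hKsupp _ _ _)
      hcontract hloc hρ0 hρ1 (fun c x hx => hsum c.1 x hx) hμ' hν' Λ (fun _ => True) (κ := κarr) hκarr0 ?_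
      (d := dsol) (fun x => by positivity) ?_ ?_ hfm hBf hfdep hδ hΔΛ
    · refine key.trans ?_
      rw [Finset.mul_sum, Finset.mul_sum, ← Finset.sum_add_distrib]
      refine Finset.sum_le_sum fun x hx => ?_
      have hδx := hδ.nonneg x
      have h0 : linkSetDist Δ x = 0 := linkSetDist_eq_zero_of_mem hx
      have hℓNx : ℓN x = ⌊max (r - 1) 0 / (D + 2 : ℕ)⌋₊ := by
        show ⌊max (r - 1 - linkSetDist Δ x) 0 / (D + 2 : ℕ)⌋₊ = _; rw [h0, sub_zero]
      have h1 : ρ ^ ℓN x ≤ ρ ^ ⌊max (r - 1) 0 / (D + 2 : ℕ)⌋₊ := by rw [hℓNx]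
      have h2 : ρ ^ ℓ x ≤ ρ ^ L₀ := pow_le_pow_of_le_one hρ0 hρ1.le (hL x hx)
      simp only [hdsol]
      nlinarith [mul_nonneg hK₁0 hδx, mul_nonneg hR₀ hδx, mul_nonneg hK₀0 hδx]
    · -- the defect of the kernels at a usable star: the window load, two levels
      intro c _ _ _ σ g hgm hgb _ δ' hδ'
      obtain ⟨Bg, hBg⟩ := hgb
      have hwd := window_defect_le (N * β) hW hWb hV hVb hsupp hsuppV hoscV (starWinZd c) σ hgm hBg hδ'
      refine hwd.trans ?_
      show _ ≤ ∑ x ∈ starWinZd c, (if linkSetDist Δ c ≤ r then 2 * Real.sqrt N * κ₀ else 2 * Real.sqrt N * κ₁) * δ' x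
      rw [← Finset.mul_sum]
      have hs0 : 0 ≤ ∑ x ∈ starWinZd c, δ' x := Finset.sum_nonneg fun x _ => hδ'.nonneg x
      by_cases hnc : linkSetDist Δ c ≤ r
      · rw [if_pos hnc]
        have hmin : min (Real.exp (windowLoad d suppV oscV (starWinZd c)) - 1) 2 ≤ κ₀ :=
          min_le_min (by linarith [Real.exp_le_exp.2 (hnear c hnc)]) le_rfl
        calc (2 * Real.sqrt N * ∑ x ∈ starWinZd c, δ' x) * min (Real.exp (windowLoad d suppV oscV (starWinZd c)) - 1) 2
            ≤ (2 * Real.sqrt N * ∑ x ∈ starWinZd c, δ' x) * κ₀ := mul_le_mul_of_nonneg_left hmin (mul_nonneg hR₀ hs0)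
          _ = 2 * Real.sqrt N * κ₀ * ∑ x ∈ starWinZd c, δ' x := by ring
      · rw [if_neg hnc]
        have hmin : min (Real.exp (windowLoad d suppV oscV (starWinZd c)) - 1) 2 ≤ κ₁ :=
          min_le_min (by linarith [Real.exp_le_exp.2 (hfar c)]) le_rfl
        calc (2 * Real.sqrt N * ∑ x ∈ starWinZd c, δ' x) * min (Real.exp (windowLoad d suppV oscV (starWinZd c)) - 1) 2
            ≤ (2 * Real.sqrt N * ∑ x ∈ starWinZd c, δ' x) * κ₁ := mul_le_mul_of_nonneg_left hmin (mul_nonneg hR₀ hs0)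
          _ = 2 * Real.sqrt N * κ₁ * ∑ x ∈ starWinZd c, δ' x := by ring
    · -- (S1)
      intro c hcΛ hcn _ x hxc
      simp only [hdsol]
      have hsumle : ∑ y ∈ starNbhdZdR D c.1, K c.1 y x ≤ ρ := hsum c.1 x hxc
      -- constant part
      have hCpart : ∑ y ∈ starNbhdZdR D c.1, K c.1 y x * K₀ ≤ ρ * K₀ := by
        rw [← Finset.sum_mul]; exact mul_le_mul_of_nonneg_right hsumle hK₀0
      -- near-profile part: `Σ K · K₁ρ^{ℓN y} ≤ ρ K₁ ρ^{ℓN x − 1}`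
      have hNpart : ∑ y ∈ starNbhdZdR D c.1, K c.1 y x * (K₁ * ρ ^ ℓN y) ≤ ρ * (K₁ * ρ ^ (ℓN x - 1)) := by
        have hterm : ∀ y ∈ starNbhdZdR D c.1, K c.1 y x * (K₁ * ρ ^ ℓN y) ≤ K c.1 y x * (K₁ * ρ ^ (ℓN x - 1)) := by
          intro y _
          by_cases hk0 : K c.1 y x = 0
          · rw [hk0, zero_mul, zero_mul]
          · refine mul_le_mul_of_nonneg_left (mul_le_mul_of_nonneg_left ?_ hK₁0) (hK0 _ _ _)
            exact pow_le_pow_of_le_one hρ0 hρ1.le (by have := (hℓN_lip c x y hxc hk0).1; omega)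
        calc _ ≤ ∑ y ∈ starNbhdZdR D c.1, K c.1 y x * (K₁ * ρ ^ (ℓN x - 1)) := Finset.sum_le_sum hterm
          _ = (∑ y ∈ starNbhdZdR D c.1, K c.1 y x) * (K₁ * ρ ^ (ℓN x - 1)) := by rw [Finset.sum_mul]
          _ ≤ ρ * (K₁ * ρ ^ (ℓN x - 1)) := mul_le_mul_of_nonneg_right hsumle (by positivity)
      -- boundary part
      have hBpart : ∑ y ∈ starNbhdZdR D c.1, K c.1 y x * (2 * Real.sqrt N * ρ ^ ℓ y) ≤ 2 * Real.sqrt N * ρ ^ ℓ x := by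
        have hterm : ∀ y ∈ starNbhdZdR D c.1, K c.1 y x * (2 * Real.sqrt N * ρ ^ ℓ y) ≤
            K c.1 y x * (2 * Real.sqrt N * ρ ^ (ℓ x - 1)) := by
          intro y _
          by_cases hk0 : K c.1 y x = 0
          · rw [hk0, zero_mul, zero_mul]
          · refine mul_le_mul_of_nonneg_left (mul_le_mul_of_nonneg_left ?_ hR₀) (hK0 _ _ _)
            exact pow_le_pow_of_le_one hρ0 hρ1.le (by have := hℓ c x y hxc hk0; omega)
        calc _ ≤ ∑ y ∈ starNbhdZdR D c.1, K c.1 y x * (2 * Real.sqrt N * ρ ^ (ℓ x - 1)) := Finset.sum_le_sum hterm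
          _ = (∑ y ∈ starNbhdZdR D c.1, K c.1 y x) * (2 * Real.sqrt N * ρ ^ (ℓ x - 1)) := by rw [Finset.sum_mul]
          _ ≤ ρ * (2 * Real.sqrt N * ρ ^ (ℓ x - 1)) := mul_le_mul_of_nonneg_right hsumle (by positivity)
          _ ≤ 2 * Real.sqrt N * ρ ^ ℓ x := by
              rcases Nat.eq_zero_or_pos (ℓ x) with h0 | hpos
              · rw [h0]; simp only [Nat.zero_sub, pow_zero, mul_one]; nlinarith
              · have : ρ * ρ ^ (ℓ x - 1) = ρ ^ ℓ x := by rw [← pow_succ']; congr 1; omega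
                rw [← mul_assoc, mul_comm ρ (2 * Real.sqrt N), mul_assoc, this]
      have hsplit : ∑ y ∈ starNbhdZdR D c.1, K c.1 y x * (K₀ + K₁ * ρ ^ ℓN y + 2 * Real.sqrt N * ρ ^ ℓ y) =
          ∑ y ∈ starNbhdZdR D c.1, K c.1 y x * K₀ + ∑ y ∈ starNbhdZdR D c.1, K c.1 y x * (K₁ * ρ ^ ℓN y) +
            ∑ y ∈ starNbhdZdR D c.1, K c.1 y x * (2 * Real.sqrt N * ρ ^ ℓ y) := by
        rw [← Finset.sum_add_distrib, ← Finset.sum_add_distrib]; exact Finset.sum_congr rfl fun y _ => by ring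
      rw [hsplit]
      -- the defect against the two levels
      have hK₀def : ρ * K₀ + 2 * Real.sqrt N * κ₀ = K₀ := by rw [hK₀]; field_simp; ring
      have hK₁def : ρ * K₁ + 2 * Real.sqrt N * κ₁ = K₁ := by rw [hK₁]; field_simp; ring
      rcases Nat.eq_zero_or_pos (ℓN x) with h0 | hpos
      · -- depth zero: the profile term is `K₁`, which absorbs either level of defect
        have hN0 : ∑ y ∈ starNbhdZdR D c.1, K c.1 y x * (K₁ * ρ ^ ℓN y) ≤ ρ * K₁ := by
          have := hNpart; rw [h0] at this; simpa using this
        have hκle : κarr c x ≤ 2 * Real.sqrt N * κ₁ + 2 * Real.sqrt N * κ₀ := by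
          simp only [hκarr]; split_ifs
          · linarith [mul_nonneg hR₀ hκ₁0]
          · linarith [mul_nonneg hR₀ hκ₀0]
        have hx1 : K₁ * ρ ^ ℓN x = K₁ := by rw [h0, pow_zero, mul_one]
        rw [hx1]
        linarith [hCpart, hN0, hBpart, hκle, hK₀def, hK₁def]
      · -- positive depth: the star is near, defect `2√N κ₀` absorbed by `K₀`; the profile contracts
        have hnearc : linkSetDist Δ c ≤ r := hℓN_near c x hxc (by omega)
        have hκeq : κarr c x = 2 * Real.sqrt N * κ₀ := by simp only [hκarr, if_pos hnearc]
        have hpow : ρ * (K₁ * ρ ^ (ℓN x - 1)) = K₁ * ρ ^ ℓN x := by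
          have : ρ * ρ ^ (ℓN x - 1) = ρ ^ ℓN x := by rw [← pow_succ']; congr 1; omega
          rw [← this]; ring
        rw [hpow] at hNpart
        rw [hκeq]
        linarith [hCpart, hNpart, hBpart, hK₀def]
    · -- (S2): a site of `Λ` in no usable star has exhaustion depth `0`
      intro x _ hx
      simp only [hdsol]
      have hx0 : ℓ x = 0 := by
        by_contra hne
        obtain ⟨hcΛ, hcn⟩ := hU x hne x (self_mem_starWinZd x)
        exact hx x hcΛ hcn trivial (self_mem_starWinZd x)
      rw [hx0, pow_zero, mul_one]
      have : 0 ≤ K₀ + K₁ * ρ ^ ℓN x := by positivity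
      linarith
  -- `L₀ → ∞`
  have hsum0 : 0 ≤ ∑ y ∈ Δ, δ y := Finset.sum_nonneg fun y _ => hδ.nonneg y
  have hgoal : (K₀ + K₁ * ρ ^ ⌊max (r - 1) 0 / (D + 2 : ℕ)⌋₊) * ∑ y ∈ Δ, δ y =
      2 * Real.sqrt N / (1 - ρ) * (κ₀ + κ₁ * ρ ^ ⌊max (r - 1) 0 / (D + 2 : ℕ)⌋₊) * ∑ y ∈ Δ, δ y := by
    rw [hK₀, hK₁]; field_simp
  rw [← hgoal]
  have hZpos : (0 : ℝ) < 2 * Real.sqrt N * ∑ y ∈ Δ, δ y + 1 := add_pos_of_nonneg_of_pos (mul_nonneg hR₀ hsum0) one_pos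
  refine le_of_forall_pos_le_add fun η hη => ?_
  obtain ⟨L₀, hL₀⟩ := exists_pow_lt_of_lt_one (div_pos hη hZpos) hρ1
  refine (main L₀).trans (add_le_add le_rfl ?_)
  have hρL : 0 ≤ ρ ^ L₀ := pow_nonneg hρ0 L₀
  have h1 : 2 * Real.sqrt N * ρ ^ L₀ * ∑ y ∈ Δ, δ y ≤ ρ ^ L₀ * (2 * Real.sqrt N * ∑ y ∈ Δ, δ y + 1) := by
    nlinarith [mul_nonneg hR₀ hsum0]
  have h2 : ρ ^ L₀ * (2 * Real.sqrt N * ∑ y ∈ Δ, δ y + 1) ≤ η := by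
    have := (lt_div_iff₀ hZpos).1 hL₀
    linarith
  exact h1.trans h2

end Summit.Ventures.YMGap.RobustBall

end
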